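import Mathlib
import Literature.AlgebraicGeometry.Tropical.TorusCycles
import Summits.HodgeConjecture.HodgeConjecture.Theorems.TropicalWeilObstructionTropicalWeilVanishingGenericSection
import HarnessLib

/-!
# Crux `TropicalWeilVanishing` (stmt-HodgeConjecture-18478), line `identity_transfer` — density of
# integral isogenies in the Weil period domain (for the registered stub `stub_transportToIdentity`)

Route `TropicalWeilObstruction` of `HodgeConjecture`. `exists_integral_isogeny`: for a positive
definite period `Q` commuting with `J = weilJ n` and any open `U ∋ Q` there are an INTEGER matrix `F`
commuting with `J`, `det F ≠ 0`, and `λ > 0` with `λ · (Fᵀ F)⁻¹ ∈ U`. (The congruence orbit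
`{λ (FᵀF)⁻¹}` of the identity period under rational `ℤ[i]`-linear isogenies and homotheties is dense in
the Weil period domain: `Q⁻¹ = C²` with `C = √(Q⁻¹)` symmetric, positive and commuting with `J`
(continuous functional calculus), `J`-commuting matrices `[[A, -B], [B, A]]` with rational entries are
dense among real ones, `G ↦ (GᵀG)⁻¹` is continuous at `C` with value `Q`, and `F = D · G₀` for a
rational `G₀` with denominators dividing `D`.) Also the entry lemmas `mul_weilJ_apply_hi`,
`weilJ_mul_apply_lo`.

Mathlib (`CFC.sqrt`, `Commute.cfc_nnreal`, `continuousAt_matrix_inv`) + tree `weilJ` entry lemmas;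
no definition, no named fact, no sorry.

## References

* [Zharkov2020TropicalWeil] I. Zharkov, Tropical abelian varieties, Weil classes and the Hodge
  conjecture, arXiv:2002.02347 (2020), §2 (pp. 2–4).
* [MikhalkinZharkov2014Eigenwave] G. Mikhalkin, I. Zharkov, Tropical eigenwave and intermediate
  Jacobians, LN UMI 15 (2014), Def. 6.1.
-/

-- `Summit.HodgeConjecture.HodgeConjecture.…` is the mandated namespace (single-conjunct summit).
set_option linter.dupNamespace false

noncomputable section

open scoped BigOperators Matrix MatrixOrder
open Matrix Literature.AlgebraicGeometry.Tropical

namespace Summit.HodgeConjecture.HodgeConjecture.Theorems.TropicalWeilVanishing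

variable {n : ℕ}

/-- Entry formula: `(X J)_{a, b+n} = -X_{a, b}` (`b < n`). [folklore] -/
theorem mul_weilJ_apply_hi (X : Matrix (Fin (2 * n)) (Fin (2 * n)) ℝ) (a : Fin (2 * n)) (b : Fin n) :
    (X * weilJ n) a ⟨(b : ℕ) + n, by omega⟩ = -X a ⟨(b : ℕ), by omega⟩ := by
  have h : (X * weilJ n) a ⟨(b : ℕ) + n, by omega⟩ = (X a ᵥ* weilJ n) ⟨(b : ℕ) + n, by omega⟩ := rfl
  rw [h, vecMul_weilJ, Pi.neg_apply, weilJ_mulVec_apply_hi]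

/-- Entry formula: `(J X)_{a, b} = -X_{a+n, b}` (`a < n`). [folklore] -/
theorem weilJ_mul_apply_lo (X : Matrix (Fin (2 * n)) (Fin (2 * n)) ℝ) (a : Fin n) (b : Fin (2 * n)) :
    (weilJ n * X) ⟨(a : ℕ), by omega⟩ b = -X ⟨(a : ℕ) + n, by omega⟩ b := by
  have := weilJ_mulVec_apply_lo (fun c => X c b) a
  simpa [Matrix.mul_apply, Matrix.mulVec, dotProduct] using this

/-- **Integral isogenies are dense in the Weil period domain (congruence orbit of the identity).**
For `Q` positive definite commuting with `J = weilJ n` and `U` an open neighbourhood of `Q`, there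
are an integer matrix `F` commuting with `J` with `det F ≠ 0` and `λ > 0` such that
`λ · (Fᵀ F)⁻¹ ∈ U`. [cite: Zharkov2020TropicalWeil, §2 (pp. 2–4)] [cite: MikhalkinZharkov2014Eigenwave, Def. 6.1] -/
theorem exists_integral_isogeny {Q : Matrix (Fin (2 * n)) (Fin (2 * n)) ℝ} (hQ : Q.PosDef)
    (hQJ : Q * weilJ n = weilJ n * Q) (U : Set (Matrix (Fin (2 * n)) (Fin (2 * n)) ℝ))
    (hU : IsOpen U) (hQU : Q ∈ U) :
    ∃ (F : Matrix (Fin (2 * n)) (Fin (2 * n)) ℤ) (lam : ℝ),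
      F.det ≠ 0 ∧ F.map ((↑) : ℤ → ℝ) * weilJ n = weilJ n * F.map ((↑) : ℤ → ℝ) ∧ 0 < lam ∧
      lam • ((F.map ((↑) : ℤ → ℝ))ᵀ * F.map ((↑) : ℤ → ℝ))⁻¹ ∈ U := by
  classical
  -- `Q⁻¹` is positive definite and commutes with `J`
  have hQdet : IsUnit Q.det := (Matrix.isUnit_iff_isUnit_det Q).mp hQ.isUnit
  have hQinv : Q⁻¹.PosDef := hQ.inv
  have hQinvJ : Commute Q⁻¹ (weilJ n) := by
    have h1 : Q⁻¹ * (Q * weilJ n) * Q⁻¹ = Q⁻¹ * (weilJ n * Q) * Q⁻¹ := by rw [hQJ]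
    rw [← Matrix.mul_assoc, Matrix.nonsing_inv_mul Q hQdet, Matrix.one_mul, Matrix.mul_assoc,
      Matrix.mul_assoc, Matrix.mul_nonsing_inv Q hQdet, Matrix.mul_one] at h1
    exact h1.symm
  -- `C = √(Q⁻¹)`: `C C = Q⁻¹`, `C` symmetric, invertible, commuting with `J`
  set C : Matrix (Fin (2 * n)) (Fin (2 * n)) ℝ := CFC.sqrt Q⁻¹ with hC
  have hCC : C * C = Q⁻¹ := CFC.sqrt_mul_sqrt_self Q⁻¹ hQinv.posSemidef.nonneg
  have hCJ : C * weilJ n = weilJ n * C := by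
    have h : Commute (CFC.sqrt Q⁻¹) (weilJ n) := by
      rw [CFC.sqrt_eq_cfc]
      exact hQinvJ.cfc_nnreal _
    exact h.eq
  have hCpsd : C.PosSemidef := Matrix.nonneg_iff_posSemidef.mp (CFC.sqrt_nonneg Q⁻¹)
  have hCsymm : Cᵀ = C := by
    have h := hCpsd.1
    rw [Matrix.IsHermitian, Matrix.conjTranspose_eq_transpose_of_trivial] at h
    exact h
  have hCunit : IsUnit C := (CFC.isUnit_sqrt_iff Q⁻¹ hQinv.posSemidef.nonneg).2 hQinv.isUnit
  have hCdet : C.det ≠ 0 := ((Matrix.isUnit_iff_isUnit_det C).mp hCunit).ne_zero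
  have hCCinv : (Cᵀ * C)⁻¹ = Q := by
    rw [hCsymm, hCC, Matrix.nonsing_inv_nonsing_inv Q hQdet]
  -- block relations of `C`
  have cblk1 := fun a b : Fin n => TropicalWeilSupply.Negative.apply_add_add_of_commute hCJ a b
  have cblk2 := fun a b : Fin n => apply_lo_hi_of_commute hCJ a b
  -- the neighbourhood `W` of `C` where `(GᵀG)⁻¹ ∈ U` and `det G ≠ 0`
  have hcontAt : ContinuousAt (fun G : Matrix (Fin (2 * n)) (Fin (2 * n)) ℝ => (Gᵀ * G)⁻¹) C := by
    have h1 : Continuous fun G : Matrix (Fin (2 * n)) (Fin (2 * n)) ℝ => Gᵀ * G :=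
      continuous_id.matrix_transpose.matrix_mul continuous_id
    have h2 : ContinuousAt Inv.inv (Cᵀ * C) := by
      apply continuousAt_matrix_inv
      rw [Ring.inverse_eq_inv']
      apply continuousAt_inv₀
      rw [Matrix.det_mul, Matrix.det_transpose]
      exact mul_ne_zero hCdet hCdet
    exact ContinuousAt.comp (f := fun G : Matrix (Fin (2 * n)) (Fin (2 * n)) ℝ => Gᵀ * G)
      (g := Inv.inv) h2 h1.continuousAt
  have hW : {G : Matrix (Fin (2 * n)) (Fin (2 * n)) ℝ | (Gᵀ * G)⁻¹ ∈ U ∧ G.det ≠ 0} ∈ nhds C := by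
    apply Filter.inter_mem
    · apply hcontAt.preimage_mem_nhds
      apply hU.mem_nhds
      show (Cᵀ * C)⁻¹ ∈ U
      rw [hCCinv]; exact hQU
    · exact (isOpen_ne_fun continuous_id.matrix_det continuous_const).mem_nhds hCdet
  -- the linear parametrisation `M` of the `J`-commuting matrices `[[A, -B], [B, A]]` by their top
  -- rows, with its entry formulas, homogeneity, continuity and integrality
  obtain ⟨M, M_ll, M_hl, M_hh, hMsmul, hMcont, hMint⟩ :
      ∃ M : (Fin n → Fin (2 * n) → ℝ) → Matrix (Fin (2 * n)) (Fin (2 * n)) ℝ,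
        (∀ Y (i : Fin n) (b : Fin (2 * n)), M Y ⟨(i : ℕ), by omega⟩ b = Y i b) ∧
        (∀ Y (i j : Fin n), M Y ⟨(i : ℕ) + n, by omega⟩ ⟨(j : ℕ), by omega⟩ =
          -Y i ⟨(j : ℕ) + n, by omega⟩) ∧
        (∀ Y (i j : Fin n), M Y ⟨(i : ℕ) + n, by omega⟩ ⟨(j : ℕ) + n, by omega⟩ =
          Y i ⟨(j : ℕ), by omega⟩) ∧
        (∀ (c : ℝ) Y, M (c • Y) = c • M Y) ∧ Continuous M ∧
        ∀ Yz : Fin n → Fin (2 * n) → ℤ, ∃ F : Matrix (Fin (2 * n)) (Fin (2 * n)) ℤ,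
          F.map ((↑) : ℤ → ℝ) = M (fun k b => (Yz k b : ℝ)) := by
    refine ⟨fun Y a b =>
      if ha : (a : ℕ) < n then Y ⟨a, ha⟩ b
      else if (b : ℕ) < n then
        -Y ⟨(a : ℕ) - n, by omega⟩ ⟨((b : ℕ) + n) % (2 * n), Nat.mod_lt _ (by omega)⟩
      else Y ⟨(a : ℕ) - n, by omega⟩ ⟨(b : ℕ) - n, by omega⟩, ?_, ?_, ?_, ?_, ?_, ?_⟩
    · intro Y i b
      simp only [dif_pos i.isLt]
    · intro Y i j
      have h1 : ¬ ((i : ℕ) + n < n) := by omega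
      have h2 : (j : ℕ) < n := j.isLt
      simp only [dif_neg h1, if_pos h2]
      congr 2
      · exact Fin.ext (by simp)
      · exact Fin.ext (by simp [Nat.mod_eq_of_lt (show (j : ℕ) + n < 2 * n by omega)])
    · intro Y i j
      have h1 : ¬ ((i : ℕ) + n < n) := by omega
      have h2 : ¬ ((j : ℕ) + n < n) := by omega
      simp only [dif_neg h1, if_neg h2]
      congr 1
      · exact Fin.ext (by simp)
      · exact Fin.ext (by simp)
    · intro c Y
      ext a b
      simp only [Matrix.smul_apply, Pi.smul_apply, smul_eq_mul]
      split_ifs <;> ring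
    · refine continuous_matrix fun a b => ?_
      by_cases ha : (a : ℕ) < n
      · simp only [dif_pos ha]
        exact (continuous_apply b).comp (continuous_apply (⟨(a : ℕ), ha⟩ : Fin n))
      · by_cases hb : (b : ℕ) < n
        · simp only [dif_neg ha, if_pos hb]
          exact (continuous_apply_apply (⟨(a : ℕ) - n, by omega⟩ : Fin n)
            (⟨((b : ℕ) + n) % (2 * n), Nat.mod_lt _ (by omega)⟩ : Fin (2 * n))).neg
        · simp only [dif_neg ha, if_neg hb]
          exact continuous_apply_apply (⟨(a : ℕ) - n, by omega⟩ : Fin n)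
            (⟨(b : ℕ) - n, by omega⟩ : Fin (2 * n))
    · intro Yz
      refine ⟨Matrix.of fun a b =>
        if ha : (a : ℕ) < n then Yz ⟨a, ha⟩ b
        else if (b : ℕ) < n then
          -Yz ⟨(a : ℕ) - n, by omega⟩ ⟨((b : ℕ) + n) % (2 * n), Nat.mod_lt _ (by omega)⟩
        else Yz ⟨(a : ℕ) - n, by omega⟩ ⟨(b : ℕ) - n, by omega⟩, ?_⟩
      ext a b
      simp only [Matrix.map_apply, Matrix.of_apply]
      split_ifs <;> simp
  -- block relations of `C`; `M` recovers `C` from its top rows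
  have cblk1 := fun a b : Fin n => TropicalWeilSupply.Negative.apply_add_add_of_commute hCJ a b
  have cblk2 := fun a b : Fin n => apply_lo_hi_of_commute hCJ a b
  have hMC : M (fun (k : Fin n) (b : Fin (2 * n)) => C ⟨(k : ℕ), by omega⟩ b) = C := by
    ext a b
    rcases fin_two_mul_cases a with ⟨i, rfl⟩ | ⟨i, rfl⟩
    · rw [M_ll]
    · rcases fin_two_mul_cases b with ⟨j, rfl⟩ | ⟨j, rfl⟩
      · rw [M_hl, cblk2, neg_neg]
      · rw [M_hh, cblk1]
  -- every `M Y` commutes with `J`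
  have hMJ : ∀ Y, M Y * weilJ n = weilJ n * M Y := by
    intro Y
    ext a b
    rcases fin_two_mul_cases a with ⟨i, rfl⟩ | ⟨i, rfl⟩ <;>
      rcases fin_two_mul_cases b with ⟨j, rfl⟩ | ⟨j, rfl⟩
    · rw [TropicalWeilSupply.Negative.mul_weilJ_apply_left, weilJ_mul_apply_lo, M_ll, M_hl, neg_neg]
    · rw [mul_weilJ_apply_hi, weilJ_mul_apply_lo, M_ll, M_hh]
    · rw [TropicalWeilSupply.Negative.mul_weilJ_apply_left,
        TropicalWeilSupply.Negative.weilJ_mul_apply_right, M_hh, M_ll]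
    · rw [mul_weilJ_apply_hi, TropicalWeilSupply.Negative.weilJ_mul_apply_right, M_hl, M_ll,
        neg_neg]
  -- a rational point `Y' = Yz / D` of the open set `M⁻¹(W)` near the top rows of `C`
  have hW' : M ⁻¹' {G | (Gᵀ * G)⁻¹ ∈ U ∧ G.det ≠ 0} ∈
      nhds (fun (k : Fin n) (b : Fin (2 * n)) => C ⟨(k : ℕ), by omega⟩ b) := by
    apply hMcont.continuousAt.preimage_mem_nhds
    rw [hMC]; exact hW
  obtain ⟨ε, hε, hball⟩ := Metric.mem_nhds_iff.1 hW'
  obtain ⟨D, hD⟩ := exists_nat_one_div_lt hε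
  have hDpos : (0 : ℝ) < (D : ℝ) + 1 := by positivity
  set Dr : ℝ := (D : ℝ) + 1 with hDr
  let Yz : Fin n → Fin (2 * n) → ℤ := fun k b => ⌊C ⟨(k : ℕ), by omega⟩ b * Dr⌋
  let Y' : Fin n → Fin (2 * n) → ℝ := fun k b => (Yz k b : ℝ) / Dr
  have hY'mem : Y' ∈ Metric.ball (fun (k : Fin n) (b : Fin (2 * n)) => C ⟨(k : ℕ), by omega⟩ b) ε := by
    rw [Metric.mem_ball, dist_pi_lt_iff hε]
    intro k
    rw [dist_pi_lt_iff hε]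
    intro b
    rw [Real.dist_eq]
    have h1 : (Yz k b : ℝ) ≤ C ⟨(k : ℕ), by omega⟩ b * Dr := Int.floor_le _
    have h2 : C ⟨(k : ℕ), by omega⟩ b * Dr < (Yz k b : ℝ) + 1 := Int.lt_floor_add_one _
    have h3 : |(Yz k b : ℝ) / Dr - C ⟨(k : ℕ), by omega⟩ b| ≤ 1 / Dr := by
      rw [abs_le]
      constructor
      · have : C ⟨(k : ℕ), by omega⟩ b - 1 / Dr ≤ (Yz k b : ℝ) / Dr := by
          rw [le_div_iff₀ hDpos, sub_mul, div_mul_cancel₀ _ hDpos.ne']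
          linarith
        linarith
      · have : (Yz k b : ℝ) / Dr ≤ C ⟨(k : ℕ), by omega⟩ b := by
          rw [div_le_iff₀ hDpos]
          exact h1
        have h0 : (0 : ℝ) ≤ 1 / Dr := by positivity
        linarith
    exact lt_of_le_of_lt h3 hD
  obtain ⟨hG₀U, hG₀det⟩ := hball hY'mem
  -- the integer matrix `F = D · M(Y')`
  obtain ⟨F, hF0⟩ := hMint Yz
  have hF : F.map ((↑) : ℤ → ℝ) = Dr • M Y' := by
    have hY : (fun k b => (Yz k b : ℝ)) = Dr • Y' := by
      funext k b
      simp only [Y', Pi.smul_apply, smul_eq_mul]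
      rw [mul_div_cancel₀ _ hDpos.ne']
    rw [hF0, hY, hMsmul]
  have hdetF : (Dr • M Y').det ≠ 0 := by
    rw [Matrix.det_smul, Fintype.card_fin]
    exact mul_ne_zero (pow_ne_zero _ hDpos.ne') hG₀det
  refine ⟨F, Dr ^ 2, ?_, ?_, by positivity, ?_⟩
  · intro h
    apply hdetF
    rw [← hF, ← Int.cast_det, h, Int.cast_zero]
  · rw [hF, Matrix.smul_mul, Matrix.mul_smul, hMJ]
  · rw [hF]
    have hunit : IsUnit ((M Y')ᵀ * M Y').det := by
      rw [Matrix.det_mul, Matrix.det_transpose]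
      exact isUnit_iff_ne_zero.2 (mul_ne_zero hG₀det hG₀det)
    have hsq : (Dr • M Y')ᵀ * (Dr • M Y') = (Dr ^ 2) • ((M Y')ᵀ * M Y') := by
      rw [Matrix.transpose_smul, Matrix.smul_mul, Matrix.mul_smul, smul_smul, ← pow_two]
    have hinv : ((Dr • M Y')ᵀ * (Dr • M Y'))⁻¹ = (Dr ^ 2)⁻¹ • ((M Y')ᵀ * M Y')⁻¹ := by
      rw [hsq]
      apply Matrix.inv_eq_left_inv
      rw [Matrix.smul_mul, Matrix.mul_smul, smul_smul, Matrix.nonsing_inv_mul _ hunit,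
        inv_mul_cancel₀ (pow_ne_zero 2 hDpos.ne'), one_smul]
    rw [hinv, smul_smul, mul_inv_cancel₀ (pow_ne_zero 2 hDpos.ne'), one_smul]
    exact hG₀U

end Summit.HodgeConjecture.HodgeConjecture.Theorems.TropicalWeilVanishing

end
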